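import Summits.BirchSwinnertonDyer.BirchSwinnertonDyer.Theorems.SchneiderFreeAdditiveX3GordCellThreeAnomalousOfTree
import Summits.BirchSwinnertonDyer.BirchSwinnertonDyer.Theorems.SchneiderFreeAdditiveX3GordCellThreeAnomalousClassCurrencyOfPT
import Summits.BirchSwinnertonDyer.BirchSwinnertonDyer.Theorems.EisensteinPrimesResidualCharacterSelmerFiniteOfFact
import HarnessLib

/-!
# Route `SchneiderFreeAdditiveX3` (K1 door): the `p = 3` column of crux r3's own currency, CLASS-WIDE, WITHOUT [RH], [PWL-θ], the Milne binder and the CGLS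
# Prop. 14 binder (FILE 4 of generation 41's [RH] re-key; twins of generation 40's F40f)

Cell `bsd-schneider-ideate`, seat `bsd-schneider-door-c5` (prover, generation 41; assembly layer; `--supports` 19177).  PARTITION: board row
B6 ∩ X3 ∩ sst-twist, `r = 1`, the WHOLE (G-ord, `e = 2`) half at `p = 3` (2 411 census pairs: 686 NAT + 1 725 anomalous; class-wide) of
`Rank1Residual.partition` — ASSEMBLY; types-the-object-of nothing new; RE-KEYS F40f `KYBranchThreeAnomalousClassCurrencyOfPT` off the binders `hPT` (the tree
theorem `PoitouTateShaNaturalAtTC.forall_poitouTate_shaRestricted_tateDual_natural_at_of_isTotallyComplex`), `hRH` (Keller–Yin 2402.12781 Thm. 1.2.2 — its instance clauses from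
cell `bsd-eis`'s [BR𝟙]/[BRω] roads, FILE 2), `hPWL` (Prop. 1.2.5, F46) and `hfact` (CGLS Prop. 14, from the module clause by cell `bsd-eis`'s
`prop14_residualCharacterSelmer_finite_of_fact`); closes none of B6's cells (BSD NOT advanced).  bears_on: K1-door (19177 r3).
* §1 `xac_charIdeal_map_le_span_three_anomalous_of_dvd_of_class` — H3♭ᶜ CLASS-WIDE on the anomalous pairs: the proof of F40f with ONE change of substance — the
  torsion of `X_ac^∅(W_K)` for the UN-normalised member `W` is TRANSPORTED along a `ℚ`-isogeny `ψ : W → W₁` to the Keller–Yin-normalised member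
  (`KYBranchOnly.xac_isTorsion_of_ratIsogeny`, degree `3^m·d`, `3 ∤ d`) instead of being read from [RH]/[PWL-θ] at `W`; the torsion and `μ = 0` of `W₁` come back
  from FILE 3's H3♭ᶜ.
* §2 the lower socket per datum, class-wide anomalous; §3 the crux currency on the anomalous pairs; §4 `additiveIMCLowerBDPInputManinAt_gordTwo_three` — crux r3's
  OWN currency on the WHOLE (G-ord, `e = 2`) cell at `p = 3` (NAT branch = F39b on the tree's Milne theorem, anomalous branch = §3).
INPUT LEDGER of the `p = 3` column after this file: {Kolyvagin, Par, Hsieh A, LZZ, Castella–Hsieh signed} ∪ {[DIV.dvd] PRE, [AN3] (hna-free and NAT forms), [BR3],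
CGLS Thm 2.1.2} ∪ {CGLS Prop 1.2.5 (module clause), Cor 1.2.6 ×2; Bleher et al. 3.3.1 (Rubin); de Shalit II.6.4 (Katz); Hida Thm I} — 14 named statements, every one
refereed print except the Keller–Yin 2410.23241 clauses [DIV.dvd]/[AN3]; NOTHING from arXiv:2402.12781; no Greenberg, no duality binder.
HONEST FRAMING: compositions of tree theorems, CONDITIONAL BY NAME on the displayed statements; no definition, no named fact, no `sorry`; nothing is closed; BSD
proved for no curve; «closes rung: none».  References: [KellerYin2024b] Thm. 3.3.6, Prop. 3.4.4, §3.5, Thm. 3.5.1, Rem. 3.5.2, Assumption 2.0.3; [CastellaGrossiLeeSkinner2022]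
Thms. 1.2.2, 2.1.2, 2.2.2, Props. 1.2.5, 14, Cor. 1.2.6; [BleherEtAl2020] Thm. 3.3.1; [deShalit1987] II.6.4; [Hida2010MuInvariant] Thm. I; [Hsieh2014] Thm. A;
[LiuZhangZhang2018]; [CastellaHsieh2018]; [MilneADT2006] I Thm. 4.10 (a); [SilvermanAEC2009] III.§4, III.6.1; this seat F39b/F40f (gen 40), F47a–c (gen 41).
-/

set_option autoImplicit false
set_option linter.dupNamespace false -- the summit namespace `…BirchSwinnertonDyer.BirchSwinnertonDyer.Theorems` (Sub = Summit, D-0017) trips it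

noncomputable section


open scoped Classical NumberField

open Field NumberField IsDedekindDomain WeierstrassCurve PowerSeries
  Literature.NumberTheory.EllipticCurves Literature.NumberTheory.EllipticCurves.GreenbergSelmer
  Literature.NumberTheory.GaloisRepresentations Literature.NumberTheory.GaloisCohomology
  Literature.NumberTheory.EllipticCurves.ModularForms Literature.NumberTheory.EllipticCurves.Rank1Residual
  Literature.NumberTheory.EllipticCurves.Rank1Residual.Typed
  Literature.NumberTheory.EllipticCurves.KellerYin2024 Literature.NumberTheory.EllipticCurves.CaiShuTian2014
  Literature.NumberTheory.IwasawaTheory Literature.NumberTheory.IwasawaTheory.Greenberg2016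
  Literature.NumberTheory.IwasawaTheory.Greenberg2006
  Literature.NumberTheory.EllipticCurves.Rubin1991 Literature.NumberTheory.EllipticCurves.DeShalit1987
  Literature.NumberTheory.EllipticCurves.Hida2010MuInvariant Literature.NumberTheory.EllipticCurves.BCGKPST2020
  Summit.BirchSwinnertonDyer.Rank1Residual Summit.BirchSwinnertonDyer.Rank1Residual.X11b
  Summit.BirchSwinnertonDyer.Rank1Residual.X11b.AcSelmer Summit.BirchSwinnertonDyer.Rank1Residual.X11b.Halves
  Summit.BirchSwinnertonDyer.Rank1Residual.X11b.CongruenceLimit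
  Summit.BirchSwinnertonDyer.Rank1Residual.Additive Summit.BirchSwinnertonDyer.Rank1Residual.GaloisImage
  Summit.BirchSwinnertonDyer.BirchSwinnertonDyer.Theorems
  Summit.BirchSwinnertonDyer.BirchSwinnertonDyer.Theorems.EisensteinPrimesMuLambda
  Summit.BirchSwinnertonDyer.BirchSwinnertonDyer.Theorems.SchneiderFree
  Summit.BirchSwinnertonDyer.BirchSwinnertonDyer.Theorems.SchneiderFree.Upper
  Summit.BirchSwinnertonDyer.BirchSwinnertonDyer.Theorems.SchneiderFree.KYRead
  Summit.BirchSwinnertonDyer.BirchSwinnertonDyer.Theses.SchneiderFreeAdditiveX3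
  Summit.BirchSwinnertonDyer.BirchSwinnertonDyer.Theorems.EisensteinShaCurrency
  Summit.BirchSwinnertonDyer.BirchSwinnertonDyer.Theorems.SchneiderFreeAdditiveX3.LZZMatch
  Summit.BirchSwinnertonDyer.BirchSwinnertonDyer.Theorems.SchneiderFreeAdditiveX3.ControlDischarged
  Summit.BirchSwinnertonDyer.BirchSwinnertonDyer.Theorems.SchneiderFreeAdditiveX3.KYBranchOnly
  Summit.BirchSwinnertonDyer.BirchSwinnertonDyer.Theorems.SchneiderFreeAdditiveX3.KYBranchThreeAnomalousPerPair
  Summit.BirchSwinnertonDyer.BirchSwinnertonDyer.Theorems.SchneiderFreeAdditiveX3.AnomalousTwistNormalisedMember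
  Summit.BirchSwinnertonDyer.BirchSwinnertonDyer.Theorems.SchneiderFreeAdditiveX3.UpperThreeAnomalousOfPartnerClass
  Summit.BirchSwinnertonDyer.BirchSwinnertonDyer.Theorems.SchneiderFreeAdditiveX3.KYBranchThreeAnomalousDoorOfPT
  Summit.BirchSwinnertonDyer.BirchSwinnertonDyer.Theorems.SchneiderFreeAdditiveX3.KYBranchThreeAnomalousDoorOfTree
  Summit.BirchSwinnertonDyer.BirchSwinnertonDyer.Theorems.SchneiderFreeAdditiveX3.KYBranchThreeAnomalousClassCurrencyOfPT
open Literature.NumberTheory.EllipticCurves.CastellaGrossiLeeSkinner2022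
  (prop14_residualCharacterSelmer_finite thm212_exists_isKatzLFunction prop125_characterGrSelmerDual_torsion_muZero_dim prop125_characterGrSelmerDual_corank_ge
    cor126_residualCharacter_globalLift cor126_residualCharacter_localSurjective)
open Literature.NumberTheory.EllipticCurves.KellerYin2024 (thm351_anacong_branch_three_allTwists)
open Summit.BirchSwinnertonDyer.BirchSwinnertonDyer.Theorems.PoitouTateShaNaturalAtTC (forall_poitouTate_shaRestricted_tateDual_natural_at_of_isTotallyComplex)
open Summit.BirchSwinnertonDyer.BirchSwinnertonDyer.Theorems.TeichmullerPairUnramifiedAtMult (prop14_residualCharacterSelmer_finite_of_fact)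

namespace Summit.BirchSwinnertonDyer.BirchSwinnertonDyer.Theorems.SchneiderFreeAdditiveX3.KYBranchThreeAnomalousClassCurrencyOfTree


/-- **H3♭ᶜ at a ♭-frame of the conjugate prime at `p = 3`, CLASS-WIDE on the anomalous pairs (isogeny transport to the normalised member) — no Milne binder, no [RH], no
[PWL-θ].**  F40f's `…of_dvd_of_class` with the torsion of the un-normalised member's `X_ac^∅` transported along `ψ : W → W₁` (`KYBranchOnly.xac_isTorsion_of_ratIsogeny`)
and the normalised member's torsion / `μ = 0` returned by FILE 3. [claim: KellerYin2024PotOrd, status: under-review]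
[cite: KellerYin2024b, Thm. 3.5.1, Rem. 3.5.2, Assumption 2.0.3 (arXiv:2410.23241 pp. 8, 20) (preprint)] [cite: CastellaGrossiLeeSkinner2022, Thms. 1.2.2, 2.1.2, 2.2.2]
[cite: BleherEtAl2020, §3.3 Thm. 3.3.1] [cite: SilvermanAEC2009, III.§4 (p. 66) and Thm. III.6.1(a)] -/
theorem xac_charIdeal_map_le_span_three_anomalous_of_dvd_of_class
    (hCHσ : castellaHsieh2018_exists_isBranchBDPLFunction_signed)
    (hDVD : thm336_dvd_branch_OPEN) (hAN : thm351_anacong_branch_three_allTwists) (h212 : thm212_exists_isKatzLFunction)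
    (h331 : thm331_rubin_exists_katzMeasure₂_pseudoIso_span_eq)
    (hF : thmII64_katzMeasure₂_functionalEquation) (hO1 : thmI_mu_katzBranch_reflect_eq_zero)
    (hPar : nonempty_modularParametrizationData)
    -- the curve: globally minimal on the (G-ord, `e = 2`) cell at `3` with `r_an = 1` and an ANOMALOUS twist model — NO normalisation
    (W : WeierstrassCurve ℚ) [W.IsElliptic] [W.IsGloballyMinimal]
    (hr : W.analyticRank = 1) (hX : ClassX3 W 3) (hSG : SubGordTwo W 3)
    {V : WeierstrassCurve ℚ} [V.IsElliptic] [V.IsGloballyMinimal] (CV : VariableChange ℚ) (hV : GoodOrd V 3)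
    (ha : (3 : ℤ) ∣ V.frobeniusTrace 3 - 1) (hCV : CV • V.quadraticTwist ((-1 : ℚ) ^ (3 / 2) * (3 : ℕ)) = W)
    -- any parametrisation datum of `W` at level `N = N_W`
    {N : ℕ} [NeZero N] (Dt : ModularParametrizationData W N) (hN : W.conductorNorm ℤ = N)
    -- the socket's field, tower, primes, embedding datum
    {K : Type} [Field K] [NumberField K] (hK : IsImaginaryQuadratic K)
    (hHe : SatisfiesHeegnerHypothesis N K) (hodd : Odd (NumberField.discr K)) (hdK : NumberField.discr K ≠ -3)
    {κ : ZpExtension K 3} (hκ : κ.IsAnticyclotomic) (γ : absoluteGaloisGroup K) [hγ : Fact (κ.IsTopGenerator γ)]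
    {𝔭 : HeightOneSpectrum (𝓞 K)} (h𝔭 : ((3 : ℕ) : 𝓞 K) ∈ 𝔭.asIdeal)
    (he : 𝔭.asIdeal.ramificationIdx (𝓞 ℚ) = 1) (hf : 𝔭.asIdeal.inertiaDeg (𝓞 ℚ) = 1)
    {𝔭' : HeightOneSpectrum (𝓞 K)} (h𝔭' : ((3 : ℕ) : 𝓞 K) ∈ 𝔭'.asIdeal) (hne : 𝔭 ≠ 𝔭')
    {ι' : PadicAlgCl 3 ≃+* ℂ} (hι' : BranchInducesPrime 3 ι' 𝔭')
    -- the ♭-frame at the conjugate prime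
    {ΩK' : ℂ} {Ωp' : ℂ_[3]} {Q : PowerSeries (PadicComplexInt 3)} (hΩK' : ΩK' ≠ 0) (hΩp' : Ωp' ≠ 0)
    (hQ : R1.IsBDPLFunctionInt 3 ι' 𝔭' κ γ Dt.f ΩK' Ωp' Q) :
    (XAc.charIdeal (W.baseChange K) 3 κ 𝔭 ∅ γ).map (PowerSeries.map (R1.toCpInt 3)) ≤ Ideal.span {Q} := by
  have hp2 : (3 : ℕ) ≠ 2 := by norm_num
  haveI : IsGalois ℚ K := Literature.FieldTheory.Galois.isGalois_of_finrank_eq_two hK.1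
  have hmodN : exists_isNewformOf := exists_isNewformOf_of_nonempty_modularParametrizationData hPar
  -- step 1: the Keller–Yin-normalised member `W₁ ~ W` (FILE 16a), on the cell with `r_an = 1` and an anomalous model (FILE 16b §1)
  obtain ⟨W₁, _, _, hiso, hnorm₁⟩ :=
    AnomalousTwistNormalisedMember.exists_isIsogenous_normalised_of_anomalousTwist (p := 3) rfl hV ha CV hCV
  obtain ⟨hX₁, hSG₁⟩ := KYBranchThreeAnomalousClass.classX3_subGordTwo_of_isIsogenous_three hX hSG hiso
  have hr₁ : W₁.analyticRank = 1 := (analyticRank_eq_of_isIsogenous' hiso).symm.trans hr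
  obtain ⟨V₁, _, _, C₁, hV₁, ha₁, hC₁⟩ := KYBranchThreeAnomalousClass.exists_anomalousModel_of_isIsogenous hV ha CV hCV hiso hX₁ hSG₁
  -- step 2: `Dt.f` is the newform of `W₁`; its level is `N_{W₁}`; an isogeny `φ : W₁ → W` of degree `3^m · d`, `3 ∤ d`
  have hiso' : IsIsogenous W₁ W := IsIsogenous.symm_of_charZero hiso
  have hfW₁ : IsNewformOf W₁ Dt.f := Dt.isNewformOf.of_isIsogenous hiso'
  have hN₁ : W₁.conductorNorm ℤ = N := (IsNewformOf.level_eq_conductorNorm_of_exists_isNewformOf hmodN hfW₁).symm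
  obtain ⟨φ⟩ := hiso'
  obtain ⟨m, d, hd, hdeg⟩ := Nat.exists_eq_pow_mul_and_not_dvd φ.degree_pos.ne' 3 (by norm_num)
  -- step 3: the split prime, the embedding at `𝔭′`
  have hsplit : ((Ideal.span {((3 : ℕ) : ℤ)}).primesOver (𝓞 K)).ncard = 2 :=
    ncard_primesOver_eq_two_of_degreeOne hK.1 h𝔭 he hf
  obtain ⟨he', hf'⟩ := degreeOne_of_splitsIn hK.1 hsplit h𝔭'
  have hne' : 𝔭' ≠ 𝔭 := fun h ↦ hne h.symm
  have hιv : ∀ x : 𝓞 K, x ∈ 𝔭'.asIdeal ↔ ‖embAt K 3 𝔭' h𝔭' he' hf' (x : K)‖ < 1 :=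
    fun x ↦ mem_asIdeal_iff_norm_embAt_lt_one 𝔭' h𝔭' he' hf' x
  -- an isogeny `ψ : W → W₁` (for the torsion transport of step 6; the torsion and `μ = 0` of the normalised member come from step 5)
  obtain ⟨ψ⟩ := hiso
  obtain ⟨m', d', hd', hdeg'⟩ := Nat.exists_eq_pow_mul_and_not_dvd ψ.degree_pos.ne' 3 (by norm_num)
  -- step 4: present `W₁` through its good-ordinary partner; parametrisation data of `W₁` (level `N`) and of the partner
  obtain ⟨W₁', _, _, C₂, hW₁, hord₁, -⟩ := exists_goodOrd_partner_presentation_of_subGordTwo_odd hp2 W₁ hX₁ hSG₁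
  subst hW₁
  subst hN₁
  haveI : NeZero (W₁'.conductorNorm ℤ) := ⟨(WeierstrassCurve.conductorNorm_pos_holds W₁').ne'⟩
  obtain ⟨Dt₁⟩ := hPar ((C₂ • ((@WeierstrassCurve.toCharNeTwoNF ℚ _ W₁' (invertibleOfNonzero two_ne_zero)) • W₁').quadraticTwist
    ((-1 : ℚ) ^ (3 / 2) * (3 : ℕ))))
  obtain ⟨Dt'⟩ := hPar W₁'
  have hpN' : ¬ 3 ∣ W₁'.conductorNorm ℤ := not_dvd_conductorNorm_of_hasGoodReductionAtPrime W₁' hord₁.1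
  have hHe' : SatisfiesHeegnerHypothesis (W₁'.conductorNorm ℤ) K :=
    SatisfiesHeegnerHypothesis.of_dvd (conductorNorm_partner_dvd_level hmodN hp2 W₁' hord₁.1 _ C₂ Dt₁) hHe
  have hcase₁ := hasGoodOrdinaryReductionOverQuadraticAt_of_subGordTwo hp2 _ hX₁ hSG₁
  -- step 5: FILE 14 §1 at the normalised member, for the frames of ITS datum's newform `Dt₁.f = Dt.f` (multiplicity one)
  have hfeq : Dt₁.f = Dt.f := Dt₁.isNewformOf.unique hfW₁
  have hQ₁ : R1.IsBDPLFunctionInt 3 ι' 𝔭' κ γ Dt₁.f ΩK' Ωp' Q := by rw [hfeq]; exact hQ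
  obtain ⟨hdiv₁, hT₁, hμ₁⟩ := KYBranchThreeAnomalousDoorOfTree.xac_charIdeal_map_le_span_three_self_anomalous_of_dvd hCHσ hDVD hAN h212 h331 hF
    hO1 hmodN W₁' hord₁.1 _ C₂ Dt₁ Dt' hpN' hK hHe hHe' hodd hdK hκ γ h𝔭 he hf h𝔭' hne hι' rfl hcase₁ hX₁ hSG₁ hr₁ C₁
    hV₁ ha₁ hC₁ hnorm₁ hΩK' hΩp' hQ₁
  -- torsion of `X_ac^∅(W_K)` transported along `ψ : W → W₁` (degree `3^{m'}·d'`, `3 ∤ d'`)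
  have hT : Module.IsTorsion (IwasawaAlgebra 3) (XAc (W.baseChange K) 3 κ 𝔭 ∅ γ) :=
    KYBranchOnly.xac_isTorsion_of_ratIsogeny κ 𝔭 ∅ γ ψ hdeg' hd' hT₁
  -- step 6: transport along `φ : W₁ → W` (finite generation unconditional; torsion of both and `μ = 0` of the source from step 3)
  haveI : Module.Finite (IwasawaAlgebra 3) (XAc (W.baseChange K) 3 κ 𝔭 ∅ γ) :=
    Literature.NumberTheory.EllipticCurves.Castella2018.AcSelmer.XAc.module_finite_empty _ 3 κ 𝔭 γ
  haveI : Module.Finite (IwasawaAlgebra 3)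
      (XAc ((C₂ • ((@WeierstrassCurve.toCharNeTwoNF ℚ _ W₁' (invertibleOfNonzero two_ne_zero)) • W₁').quadraticTwist
        ((-1 : ℚ) ^ (3 / 2) * (3 : ℕ))).baseChange K) 3 κ 𝔭 ∅ γ) :=
    Literature.NumberTheory.EllipticCurves.Castella2018.AcSelmer.XAc.module_finite_empty _ 3 κ 𝔭 γ
  exact xac_charIdeal_map_le_of_ratIsogeny κ 𝔭 ∅ γ φ hdeg hd hT₁ hT hμ₁ (PowerSeries.map (R1.toCpInt 3)) hdiv₁

/-- **The (G-ord, `e = 2`) LOWER socket AT `p = 3` off the sliver for EVERY curve of the cell with an anomalous twist (no normalisation binder) — no Milne binder, no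
[RH], no [PWL-θ]** — F40f's `…_offSliver_anomalous` on §1. [claim: KellerYin2024PotOrd, status: under-review]
[cite: KellerYin2024b, Thm. 3.3.6, Prop. 3.4.4, Thm. 3.5.1 (arXiv:2410.23241 pp. 19–20) (preprint)] [cite: Hsieh2014, Thm. A p. 712] [cite: LiuZhangZhang2018, Thm 1.5.1 and Thm 1.5.3]
[cite: BleherEtAl2020, §3.3 Thm. 3.3.1] -/
theorem additiveIMCLowerBDPOnTree_subGordTwo_three_offSliver_anomalous
    (hKo : ∀ (N : ℕ) [NeZero N] (W : WeierstrassCurve ℚ) (K : Type) [Field K] [NumberField K],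
      Literature.NumberTheory.EllipticCurves.kolyvagin N W K)
    (hPar : nonempty_modularParametrizationData)
    (hA : Hsieh2014.thmA_exists_isHsiehLFunction_unrPeriod_anyLevel)
    (hL : LiuZhangZhang2018.thm151_thm153_modularCurve_heegnerVector_additive)
    (hCHσ : castellaHsieh2018_exists_isBranchBDPLFunction_signed)
    (hDVD : thm336_dvd_branch_OPEN) (hAN : thm351_anacong_branch_three_allTwists) (h212 : thm212_exists_isKatzLFunction)
    (h331 : thm331_rubin_exists_katzMeasure₂_pseudoIso_span_eq)
    (hF : thmII64_katzMeasure₂_functionalEquation) (hO1 : thmI_mu_katzBranch_reflect_eq_zero) :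
    ∀ (W : WeierstrassCurve ℚ) [W.IsElliptic] [W.IsGloballyMinimal],
      W.analyticRank = 1 → ClassX3 W 3 → SubGordTwo W 3 →
      ∀ (V : WeierstrassCurve ℚ) [V.IsElliptic] [V.IsGloballyMinimal] (CV : VariableChange ℚ),
        GoodOrd V 3 → (3 : ℤ) ∣ V.frobeniusTrace 3 - 1 → CV • V.quadraticTwist ((-1 : ℚ) ^ (3 / 2) * (3 : ℕ)) = W →
      ∀ (N : ℕ) [NeZero N] (K : Type) [Field K] [NumberField K]
        (Dt : ModularParametrizationData W N) (H : HeegnerDatum N (NumberField.discr K)) (ι : K →+* ℂ)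
        (P : (W.baseChange K).toAffine.Point),
        W.analyticRank = 1 → Additive.N10.Locus W 3 → W.conductorNorm ℤ = N → IsImaginaryQuadratic K →
        Odd (NumberField.discr K) → ¬ 3 ∣ Units.torsionOrder K → SatisfiesHeegnerHypothesis N K →
        (W.quadraticTwist (NumberField.discr K : ℚ)).entireLFunction 1 ≠ 0 →
        WeierstrassCurve.Affine.Point.map ι.toRatAlgHom P = heegnerPointComplex Dt H →
        ¬ IsOfFinAddOrder P → NumberField.discr K ≠ -3 →
        ∀ (κ : ZpExtension K 3), κ.IsAnticyclotomic →
          ∀ (γ : Field.absoluteGaloisGroup K) [Fact (κ.IsTopGenerator γ)]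
            (𝔭 : HeightOneSpectrum (𝓞 K)) (h𝔭 : ((3 : ℕ) : 𝓞 K) ∈ 𝔭.asIdeal)
            (he : 𝔭.asIdeal.ramificationIdx (𝓞 ℚ) = 1) (hf : 𝔭.asIdeal.inertiaDeg (𝓞 ℚ) = 1),
            AdditiveIMCLowerBDPOnTreeLeAt 3 κ 𝔭 γ (embAt K 3 𝔭 h𝔭 he hf) (padicValNat 3 Dt.c.natAbs) P := by
  intro W _ _ hr hX hS V _ _ CV hV ha hCV
  have hp2 : (3 : ℕ) ≠ 2 := by norm_num
  intro N _ K _ _ Dt H ι P hr' hloc hN hK hodd hunit hHe hL1 hP hnt hdK κ hκ γ _ 𝔭 h𝔭 he hf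
  refine additiveIMCLowerBDPOnTreeLeAt_of_kolyvagin_of_hsieh_of_lzz_of_intDivConj hKo hA hL hp2 hX (Or.inr hS) Dt H ι P
    hr' hloc hN hK hodd hunit hHe hL1 hP hnt κ hκ γ 𝔭 h𝔭 he hf ?_
  intro 𝔮 h𝔮 hne _ _ ι' hι' ΩK Ωp Q hΩK hΩp hQ
  exact xac_charIdeal_map_le_span_three_anomalous_of_dvd_of_class hCHσ hDVD hAN h212 h331 hF hO1 hPar
    W hr hX hS CV hV ha hCV Dt hN hK hHe hodd hdK hκ γ h𝔭 he hf h𝔮 hne hι' hΩK hΩp hQ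

/-- **Crux r3's own currency `AdditiveIMCLowerBDPInputManinAt W 3` on the ANOMALOUS pairs of the (G-ord, `e = 2`) cell, class-wide — no Milne binder, no [RH], no
[PWL-θ]** — F40f's `…_three_anomalous_class` (sliver void at `3`) on §2. [claim: KellerYin2024PotOrd, status: under-review]
[cite: KellerYin2024b, Thm. 3.3.6, Prop. 3.4.4, §3.5, Thm. 3.5.1 (arXiv:2410.23241 pp. 19–20) (preprint)] [cite: BleherEtAl2020, §3.3 Thm. 3.3.1]
[cite: deShalit1987, II.6.4] [cite: Hida2010MuInvariant, Thm. I] -/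
theorem additiveIMCLowerBDPInputManinAt_gordTwo_three_anomalous_class
    (hKo : ∀ (N : ℕ) [NeZero N] (W : WeierstrassCurve ℚ) (K : Type) [Field K] [NumberField K],
      Literature.NumberTheory.EllipticCurves.kolyvagin N W K)
    (hPar : nonempty_modularParametrizationData)
    (hA : Hsieh2014.thmA_exists_isHsiehLFunction_unrPeriod_anyLevel)
    (hL : LiuZhangZhang2018.thm151_thm153_modularCurve_heegnerVector_additive)
    (hCHσ : castellaHsieh2018_exists_isBranchBDPLFunction_signed)
    (hDVD : thm336_dvd_branch_OPEN) (hAN : thm351_anacong_branch_three_allTwists) (h212 : thm212_exists_isKatzLFunction)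
    (h331 : thm331_rubin_exists_katzMeasure₂_pseudoIso_span_eq)
    (hFE : thmII64_katzMeasure₂_functionalEquation) (hO1 : thmI_mu_katzBranch_reflect_eq_zero) :
    ∀ (W : WeierstrassCurve ℚ) [W.IsElliptic] [W.IsGloballyMinimal],
      W.analyticRank = 1 → ClassX3 W 3 → Additive.SubGordTwo W 3 →
      ∀ (V : WeierstrassCurve ℚ) [V.IsElliptic] [V.IsGloballyMinimal] (CV : VariableChange ℚ),
        GoodOrd V 3 → (3 : ℤ) ∣ V.frobeniusTrace 3 - 1 → CV • V.quadraticTwist ((-1 : ℚ) ^ (3 / 2) * (3 : ℕ)) = W →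
      AdditiveIMCLowerBDPInputManinAt W 3 := by
  intro W _ _ hr hX hS V _ _ CV hV ha hCV N _ K _ _ Dt H ι P hr' hloc hN hK hodd hunit hHe hL1 hP hnt κ hκ γ _ 𝔭 h𝔭 he hf
  -- the `d_K = −3` sliver is void at `p = 3`
  have hdK : NumberField.discr K ≠ -3 := fun hd ↦ sliver_void_at_three hK hd rfl hunit
  exact additiveIMCLowerBDPOnTree_subGordTwo_three_offSliver_anomalous hKo hPar hA hL hCHσ hDVD hAN h212 h331 hFE hO1 W hr hX hS V CV hV
    ha hCV N K Dt H ι P hr' hloc hN hK hodd hunit hHe hL1 hP hnt hdK κ hκ γ 𝔭 h𝔭 he hf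

/-! ### §4 Crux r3's own currency on the WHOLE (G-ord, `e = 2`) cell at `p = 3`: 14 named statements, none from arXiv:2402.12781 -/

/-- **Crux r3's OWN currency `AdditiveIMCLowerBDPInputManinAt W 3` on the WHOLE (G-ord, `e = 2`) cell at `p = 3`, NO per-lattice hypothesis — no Greenberg, no duality
binder, no [RH], no [PWL-θ], no separate finiteness clause.**  F40f's `additiveIMCLowerBDPInputManinAt_gordTwo_three` re-typed: NAT branch = F39b's
`KYBranchThreeDoorOfCGLS.additiveIMCLowerBDPInputManinAt_gordTwo_three_of_print_of_forall_twist` on the tree's Milne ADT I Thm. 4.10 (a) (its corank clause `hge` from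
the module clause by cell `bsd-eis`'s «SUR-Λ»/«OfSurC», its CGLS Prop. 14 clause by `prop14_residualCharacterSelmer_finite_of_fact`), anomalous branch = §3.
INPUT LEDGER of the `p = 3` column: {Kolyvagin, Par, Hsieh A, LZZ, Castella–Hsieh signed} ∪ {[DIV.dvd] PRE, [AN3] (hna-free and NAT forms), [BR3], CGLS Thm 2.1.2} ∪
{CGLS Prop 1.2.5 (module clause), Cor 1.2.6 (i), (ii); Bleher et al. 2020 Thm 3.3.1; de Shalit II.6.4; Hida Thm I}.  CONDITIONAL on all displayed hypotheses; the crux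
stays OPEN; BSD NOT advanced. [claim: KellerYin2024PotOrd, status: under-review]
[cite: KellerYin2024b, Thm. 3.3.6, Prop. 3.4.4, §3.5 (p. 20 L15–21), Thm. 3.5.1 (arXiv:2410.23241) (preprint; hypotheses)]
[cite: CastellaGrossiLeeSkinner2022, Thms. 1.2.2, 2.1.2, 2.2.2, Props. 1.2.5, 14, Cor. 1.2.6] [cite: BleherEtAl2020, §3.3 Thm. 3.3.1] [cite: deShalit1987, II.6.4]
[cite: Hida2010MuInvariant, Thm. I] [cite: MilneADT2006, I Thm. 4.10 (a)] [cite: Greenberg2016Selmer, Prop. 2.6.3 (c)] -/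
theorem additiveIMCLowerBDPInputManinAt_gordTwo_three
    (hKo : ∀ (N : ℕ) [NeZero N] (W : WeierstrassCurve ℚ) (K : Type) [Field K] [NumberField K],
      Literature.NumberTheory.EllipticCurves.kolyvagin N W K)
    (hPar : nonempty_modularParametrizationData)
    (hA : Hsieh2014.thmA_exists_isHsiehLFunction_unrPeriod_anyLevel)
    (hL : LiuZhangZhang2018.thm151_thm153_modularCurve_heegnerVector_additive)
    (hCHσ : castellaHsieh2018_exists_isBranchBDPLFunction_signed)
    (hDVD : thm336_dvd_branch_OPEN) (hAN3 : thm351_anacong_branch_three) (hAN : thm351_anacong_branch_three_allTwists)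
    (hBR : thm122_charLambda_pair_three) (h212 : thm212_exists_isKatzLFunction)
    (hprop125 : prop125_characterGrSelmerDual_torsion_muZero_dim)
    (hlift : cor126_residualCharacter_globalLift) (hlocal : cor126_residualCharacter_localSurjective)
    (h331 : thm331_rubin_exists_katzMeasure₂_pseudoIso_span_eq)
    (hFE : thmII64_katzMeasure₂_functionalEquation) (hO1 : thmI_mu_katzBranch_reflect_eq_zero) :
    ∀ (W : WeierstrassCurve ℚ) [W.IsElliptic] [W.IsGloballyMinimal],
      W.analyticRank = 1 → ClassX3 W 3 → Additive.SubGordTwo W 3 → AdditiveIMCLowerBDPInputManinAt W 3 := by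
  intro W _ _ hr hX hS
  -- CGLS Prop. 1.2.5's corank clause from its module clause (cell `bsd-eis`: «SUR-Λ» on the tree's Milne ADT I Thm. 4.10 (a), then «OfSurC»; Greenberg
  -- 2006 by tree theorems) and its finiteness clause (CGLS Prop. 14) from the module clause (`prop14_residualCharacterSelmer_finite_of_fact`)
  have hge : prop125_characterGrSelmerDual_corank_ge :=
    CharGrSelmerCorankGeOfFacts.prop125_characterGrSelmerDual_corank_ge_of_facts_ofSurC
      (SurLambda.prop263_sur_of_crk_caseC_tc_of_poitouTateNaturalAt forall_poitouTate_shaRestricted_tateDual_natural_at_of_isTotallyComplex)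
      KYBranchGreenbergDischarged.greenberg2006_prop41_ofTree
      Greenberg2006.prop42_localEulerPoincareCorank_holds Greenberg2006.sec5A_localH2_subsingleton_of_LOC1_holds hprop125
  have hfact : prop14_residualCharacterSelmer_finite := prop14_residualCharacterSelmer_finite_of_fact hprop125
  rcases forall_twist_not_anomalous_or_exists_anomalous_twist W hX hS with hNAT | ⟨V, _, _, C, hV, hC, ha⟩
  · exact KYBranchThreeDoorOfCGLS.additiveIMCLowerBDPInputManinAt_gordTwo_three_of_print_of_forall_twist hKo hPar hA hL hCHσ hDVD hAN3
      hBR h212 hprop125 hge hfact hlift hlocal forall_poitouTate_shaRestricted_tateDual_natural_at_of_isTotallyComplex W hr hX hS hNAT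
  · have hC' : C • V.quadraticTwist ((-1 : ℚ) ^ (3 / 2) * (3 : ℕ)) = W := by
      rw [show ((-1 : ℚ) ^ (3 / 2) * (3 : ℕ) : ℚ) = -3 by norm_num]; exact hC
    exact additiveIMCLowerBDPInputManinAt_gordTwo_three_anomalous_class hKo hPar hA hL hCHσ hDVD hAN h212 h331 hFE hO1 W hr hX hS V C hV ha hC'

end Summit.BirchSwinnertonDyer.BirchSwinnertonDyer.Theorems.SchneiderFreeAdditiveX3.KYBranchThreeAnomalousClassCurrencyOfTree

end
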